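import Mathlib.Data.Finset.Card
import Literature.Computability.MetaComplexity.ResLin
import Literature.Computability.MetaComplexity.ResLinProofs
import Literature.Computability.MetaComplexity.RevResLin
import Literature.Computability.MetaComplexity.ResLinWinningStrategy
import HarnessLib

/-!
# Width from winning strategies (Gryaznov–Ovcharov–Riazanov 2024, Lemma 6)

The converse direction of the combinatorial characterisation of Res(⊕) width by winning strategies
(`Literature/Computability/MetaComplexity/ResLinWinningStrategy.lean`, Lemma 5 =
`isWinningStrategy_of_forall_lt_card`): [GOR 2024, Lemma 6] *if a linear CNF formula `φ` has a
`(k+1)`-winning strategy, then `φ` does not have a Res(⊕) refutation of width `k`* (width = number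
of linear literals of a line; resolution rule + SEMANTIC weakening).

* `IsWinningStrategy.exists_sat_of_derivableWithin` — the invariant of GOR's proof: every clause
  derivable within literal-width `k` is satisfied by some solution of every system of the strategy;
* `IsWinningStrategy.exists_lt_card` — hence every Res(⊕) refutation has a line with more than `k`
  linear literals. (No statement about the tree's RANK width follows in this direction, since
  rank `≤` number of literals; none is claimed.)

## References

* S. Gryaznov, S. Ovcharov, A. Riazanov, *Resolution over linear equations: combinatorial games
  for tree-like size and space*, ACM ToCT 16(3) (2024), §4, Lemma 6 [GryaznovOvcharovRiazanov2024].
* A. Atserias, V. Dalmau, JCSS 74 (2008), Lemma 4 (the resolution case) [AtseriasDalmau2008].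
-/

namespace Literature.Computability.MetaComplexity

open _root_.Computability Complexity

/-- A linear clause is false at `σ` iff all its literals are (local helper).
[Itsykson–Sokolov 2020, §2] [cite: ItsyksonSokolov2020, §2] -/
private theorem linClause_eval_eq_false_iff_wfs (σ : ℕ → Bool) (C : LinClause) :
    C.eval σ = false ↔ ∀ l ∈ C, LinLit.eval σ l = false := by
  unfold LinClause.eval
  simp only [decide_eq_false_iff_not, not_exists, not_and, Bool.not_eq_true]

/-- Negating the constant negates the literal (local helper). [Itsykson–Sokolov 2020, §2]
[cite: ItsyksonSokolov2020, §2] -/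
private theorem linLit_eval_not_wfs (σ : ℕ → Bool) (f : Finset ℕ) (b : Bool) :
    LinLit.eval σ (f, !b) = !LinLit.eval σ (f, b) := by
  cases b
  · exact LinLit.eval_true_eq_not σ f
  · have h := LinLit.eval_true_eq_not σ f
    simp only [Bool.not_true]
    rw [h, Bool.not_not]

/-- **GOR Lemma 6, the invariant.** If `H` is a `(k+1)`-winning strategy for `φ`, then for every
system `F ∈ H` and every linear clause `C` derivable from `φ` within literal-width `k` there is a
solution of `F` satisfying `C` (induction on the derivation: initial clauses by property (2),
weakening trivially, resolution via properties (3) and (4) applied to the system `¬(C ∨ D)`).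
[cite: GryaznovOvcharovRiazanov2024, Lemma 6] -/
theorem IsWinningStrategy.exists_sat_of_derivableWithin {φ : CNF ℕ} {k : ℕ}
    {H : Set (Finset LinLit)} (hH : IsWinningStrategy φ (k + 1) H) {C : LinClause}
    (hC : ResLinDerivableWithin φ k C) :
    ∀ F ∈ H, ∃ σ : ℕ → Bool, (∀ e ∈ F, LinLit.eval σ e = true) ∧ C.eval σ = true := by
  classical
  induction hC with
  | initial c hc _ =>
      intro F hF
      exact hH.exists_sat F hF c hc
  | weaken C D _ himp _ ih =>
      intro F hF
      obtain ⟨σ, hσF, hσC⟩ := ih F hF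
      exact ⟨σ, hσF, himp σ hσC⟩
  | resolve C D f _ _ hk ihC ihD =>
      intro F hF
      by_contra hcon
      push Not at hcon
      -- the system `¬(C ∨ D)` is a consequence of `F`, hence in `H`
      set G : Finset LinLit := (C ∪ D).image (fun l => (l.1, !l.2)) with hG
      have hGsol : ∀ σ : ℕ → Bool, (∀ e ∈ F, LinLit.eval σ e = true) →
          ∀ e ∈ G, LinLit.eval σ e = true := by
        intro σ hσ e he
        obtain ⟨l, hl, rfl⟩ := Finset.mem_image.1 he
        have hQ : (C ∪ D).eval σ = false := by
          cases hev : (C ∪ D).eval σ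
          · rfl
          · exact absurd hev (hcon σ hσ)
        have hlf := (linClause_eval_eq_false_iff_wfs σ _).1 hQ l hl
        show LinLit.eval σ (l.1, !l.2) = true
        rw [linLit_eval_not_wfs, show (l.1, l.2) = l from rfl, hlf, Bool.not_false]
      have hGcard : G.card ≤ k := Finset.card_image_le.trans hk
      have hGmem : G ∈ H := hH.mem_of_imp F hF G hGsol (by omega)
      -- solutions of `G` falsify `C` and `D`
      have hGfalse : ∀ σ : ℕ → Bool, (∀ e ∈ G, LinLit.eval σ e = true) →
          C.eval σ = false ∧ D.eval σ = false := by
        intro σ hσ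
        have hall : ∀ l ∈ C ∪ D, LinLit.eval σ l = false := by
          intro l hl
          have h := hσ _ (Finset.mem_image_of_mem (fun l => (l.1, !l.2)) hl)
          change LinLit.eval σ (l.1, !l.2) = true at h
          rw [linLit_eval_not_wfs, show (l.1, l.2) = l from rfl] at h
          cases hev : LinLit.eval σ l
          · rfl
          · rw [hev] at h; exact absurd h (by decide)
        refine ⟨(linClause_eval_eq_false_iff_wfs σ C).2 fun l hl => hall l ?_,
          (linClause_eval_eq_false_iff_wfs σ D).2 fun l hl => hall l ?_⟩
        · exact Finset.mem_union_left _ hl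
        · exact Finset.mem_union_right _ hl
      -- extend by the resolved form `f`
      obtain ⟨a, ha⟩ := hH.exists_insert_mem G hGmem (by omega) f
      obtain ⟨σ₀, hσ₀, hσ₀C⟩ := ihC _ ha
      obtain ⟨σ₁, hσ₁, hσ₁D⟩ := ihD _ ha
      have hG₀ : ∀ e ∈ G, LinLit.eval σ₀ e = true := fun e he => hσ₀ e (Finset.mem_insert_of_mem he)
      have hG₁ : ∀ e ∈ G, LinLit.eval σ₁ e = true := fun e he => hσ₁ e (Finset.mem_insert_of_mem he)
      -- at `σ₀`: `C` false, so `(f = 0)` true, so `a = false`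
      have h0 : LinLit.eval σ₀ (f, false) = true := by
        rw [LinClause.eval_insert, (hGfalse σ₀ hG₀).1, Bool.or_false] at hσ₀C
        exact hσ₀C
      have h1 : LinLit.eval σ₁ (f, true) = true := by
        rw [LinClause.eval_insert, (hGfalse σ₁ hG₁).2, Bool.or_false] at hσ₁D
        exact hσ₁D
      have ha₀ := hσ₀ _ (Finset.mem_insert_self _ _)
      have ha₁ := hσ₁ _ (Finset.mem_insert_self _ _)
      cases a
      · -- `(f, false)` true at `σ₁` contradicts `(f, true)` true at `σ₁`
        rw [LinLit.eval_true_eq_not, ha₁] at h1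
        exact absurd h1 (by decide)
      · rw [LinLit.eval_true_eq_not, h0] at ha₀
        exact absurd ha₀ (by decide)

/-- **GOR Lemma 6.** If `φ` has a `(k+1)`-winning strategy, then every Res(⊕) refutation of `φ`
has a line with more than `k` linear literals ("`φ` does not have a Res(⊕) refutation of width
`k`"). [cite: GryaznovOvcharovRiazanov2024, Lemma 6] -/
theorem IsWinningStrategy.exists_lt_card {φ : CNF ℕ} {k : ℕ} {H : Set (Finset LinLit)}
    (hH : IsWinningStrategy φ (k + 1) H) {π : List ResLinLine} (hπ : IsResLinRefutation φ π) :
    ∃ l ∈ π, k < l.clause.card := by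
  by_contra hcon
  push Not at hcon
  obtain ⟨hder, l, hl, hlcl⟩ := hπ
  have hD := resLinDerivableWithin_of_mem hder hcon l hl
  rw [hlcl] at hD
  obtain ⟨σ, -, hσ⟩ := hH.exists_sat_of_derivableWithin hD ∅ hH.empty_mem
  simp at hσ

end Literature.Computability.MetaComplexity
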